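/-
rh-split cell (screw), width seat 2 on line L22 (route-RiemannHypothesis-ScrewQuarticNodes, desk
rh-idea-9), 2026-08-27.  The GRADED form of the route's sparse-node door (desk rh-idea-9's «graded
sparse door», same lever: prime-side semiconcavity + Landau with a slack function).  A DETECTION
theorem about `ζ`'s own screw function; RH is not proved by this and nothing here bears on the truth
of RH.
-/
import Summits.RiemannHypothesis.RiemannHypothesis.Theorems.ScrewQuarticNodesSparseNodeDoor
import Literature.NumberTheory.LFunctions.ZetaScrewSlackLandau
import HarnessLib

/-!
# Route ScrewQuarticNodes (L22) — the GRADED sparse-node screw door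
# (supports item stmt-RiemannHypothesis-22170; generalises the proved door stmt-22169)

`Ψ = zetaScrew` is Suzuki's screw function of `ζ` (Suzuki2023 (1.1)).  The landed door
`ScrewQuarticNodesSparseNodeDoor.sparseNodeDoor` (stmt-22169) says: a one-sided node bound `Ψ ≥ -K` on
a node set of `t`-gap `√(K/(e^{(a+2)/2}+1)) ≍ √K·e^{-a/4}` (`x`-gap `≍ x^{3/4}` in `x = e^a`) detects
RH.  Main result here (`gradedSparseDoor`): for every DEPTH EXPONENT `θ ≥ 0`,

  if `N ⊆ ℝ` meets every `[a, a + √(K e^{θa}/(e^{(a+2)/2}+1))]` for large `a`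
  (`t`-gap `≍ √K·e^{(θ/2 - 1/4)a}`, i.e. `x`-gap `≍ x^{3/4 + θ/2}`) and `Ψ(x) ≥ -K e^{θx}` on `N`,
  then `QuasiRiemannHypothesis (1/2 + θ)`: no zero of `ζ` with `1/2 + θ < Re s < 1`.

At `θ = 0` this is exactly the landed door (`rh_of_gradedSparseDoor_zero` re-derives RH from it via
`quasiRiemannHypothesis_one_half_iff_holds`); as `θ ↑ 1/2` the admissible gap tends to the geometric
lattice `x`-gap `≍ x` and the conclusion to the trivial `QuasiRH(1)` — the typed form of the desk's
remark that the graded law interpolates between the `x^{3/4}` door and the blind `x`-lattice (B16).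

## Proof

1. GRADED NYQUIST STEP (`gradedTailFloor`): suppose `Ψ(t₀) < -4K e^{θt₀}` at a large `t₀`.  The
   one-sided Taylor bound `zetaScrew_le_taylor` (prime-side semiconcavity, modulus
   `M = e^{(t₀+1)/2} + 1`, landed with the door) keeps `Ψ ≤ -4D₀ + ½Mδ² = -3.5 D₀`
   (`D₀ = K e^{θt₀}`, `δ² = D₀/M ≤ 1` for `t₀ ≥ log K/(1/2 - θ)`) on the one-sided window of length
   `δ` next to `t₀` (right if the slope `p ≤ 0`, left if `p > 0`); the density hypothesis puts a node
   `x` there (`g(a) ≤ δ` since `a ≤ t₀` and `a + 2 ≥ t₀ + 1`), where the node bound gives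
   `Ψ(x) ≥ -K e^{θx} ≥ -e^{θ}D₀ > -2D₀` (right, `e^{1/2} < 2`) resp. `≥ -D₀` (left) — contradiction.
   So `Ψ(t) ≥ -4K e^{θt}` eventually, and with continuity on `[0, T₁]`,
   `Ψ ≥ -(4K e^{θt} + K')` on `[0, ∞)` (`gradedGlobalSlack`).
2. SLACK LANDAU (Literature `ZetaScrewLandau.quasiRiemannHypothesis_of_zetaScrew_ge_neg_slack`,
   MontgomeryVaughan2007 Lemma 15.1 with a slack function): `D(t) = 4K e^{θt} + K'` is a slack of
   Laplace class `β` for every `β > θ` (`∫₀^∞ D e^{-βt} < ∞`), so `QuasiRH(1/2 + β)` for all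
   `β > θ`, hence `QuasiRH(1/2 + θ)` (a zero with `Re s > 1/2 + θ` is caught by some such `β`).
   For `θ ≥ 1/2` the conclusion is vacuous.

Axioms: propext, Classical.choice, Quot.sound.  References: Suzuki2023 (1.1), Thm 1.7;
MontgomeryVaughan2007 §15.1.  RH is not proved by this; nothing here bears on the truth of RH.
-/

-- D-0017: `Summit.RiemannHypothesis.RiemannHypothesis.…` duplicates the namespace BY DESIGN (single-problem summit).
set_option linter.dupNamespace false

noncomputable section

open Real Set Filter MeasureTheory

namespace Summit.RiemannHypothesis.RiemannHypothesis.Theorems.ScrewQuarticNodesGradedDoor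

open Literature.NumberTheory.LFunctions
open Summit.RiemannHypothesis.RiemannHypothesis.Theorems.ScrewQuarticNodesSparseNodeDoor
  (zetaScrew_le_taylor)

/-- `e^{1/2} < 2` (since `e < 4`). -/
private theorem exp_half_lt_two : Real.exp (1 / 2) < 2 := by
  have h := Real.exp_one_lt_d9
  have hsq : Real.exp (1 / 2) * Real.exp (1 / 2) = Real.exp 1 := by
    rw [← Real.exp_add]; norm_num
  nlinarith [Real.exp_pos (1 / 2)]

/-- **Graded Nyquist step (tail floor).**  Let `0 ≤ θ < 1/2` and `K > 0`.  If `N` meets every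
interval `[a, a + √(K e^{θa}/(e^{(a+2)/2}+1))]` for `a ≥ T₀` and `Ψ(x) ≥ -K e^{θx}` on `N`, then
`Ψ(t) ≥ -4K e^{θt}` for all large `t`.  If `Ψ(t₀) < -4K e^{θt₀}` at a large `t₀`, the one-sided
Taylor bound `zetaScrew_le_taylor` keeps `Ψ ≤ -3.5·K e^{θt₀}` on a one-sided window of length
`√(K e^{θt₀}/(e^{(t₀+1)/2}+1)) ≤ 1` next to `t₀`, which contains a node — where the node bound is at
least `-2K e^{θt₀}`. -/
theorem gradedTailFloor {θ K : ℝ} (hθ : 0 ≤ θ) (hθ' : θ < 1 / 2) (hK : 0 < K) {N : Set ℝ}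
    (hN : ∃ T₀ : ℝ, ∀ a : ℝ, T₀ ≤ a → ∃ x ∈ N, a ≤ x ∧
      x ≤ a + Real.sqrt (K * Real.exp (θ * a) / (Real.exp ((a + 2) / 2) + 1)))
    (hΨN : ∀ x ∈ N, -(K * Real.exp (θ * x)) ≤ zetaScrew x) :
    ∃ T₁ : ℝ, ∀ t : ℝ, T₁ ≤ t → -(4 * K * Real.exp (θ * t)) ≤ zetaScrew t := by
  obtain ⟨T₀, hT₀⟩ := hN
  refine ⟨max (T₀ + 1) (max 1 (Real.log K / (1 / 2 - θ))), fun t₀ ht₀ => ?_⟩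
  obtain ⟨h1, h2, h3⟩ : T₀ + 1 ≤ t₀ ∧ 1 ≤ t₀ ∧ Real.log K / (1 / 2 - θ) ≤ t₀ := by
    simpa [max_le_iff] using ht₀
  by_contra hlt
  rw [not_le] at hlt
  have hD₀pos : 0 < K * Real.exp (θ * t₀) := by positivity
  set D₀ : ℝ := K * Real.exp (θ * t₀) with hD₀
  have hlt' : zetaScrew t₀ < -(4 * D₀) := by
    have : 4 * K * Real.exp (θ * t₀) = 4 * D₀ := by rw [hD₀]; ring
    linarith
  set M : ℝ := Real.exp ((t₀ + 1) / 2) + 1 with hM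
  have hMpos : 0 < M := by positivity
  -- `D₀ ≤ M` (this is where `t₀ ≥ log K / (1/2 - θ)` is used), so the window length `δ ≤ 1`
  have hDM : D₀ ≤ M := by
    have hpos : 0 < 1 / 2 - θ := by linarith
    have hlogK : Real.log K ≤ t₀ * (1 / 2 - θ) := (div_le_iff₀ hpos).1 h3
    have hK' : K ≤ Real.exp (t₀ * (1 / 2 - θ)) := by
      calc K = Real.exp (Real.log K) := (Real.exp_log hK).symm
        _ ≤ Real.exp (t₀ * (1 / 2 - θ)) := Real.exp_le_exp.2 hlogK
    have hD₀le : D₀ ≤ Real.exp (t₀ / 2) := by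
      calc D₀ = K * Real.exp (θ * t₀) := rfl
        _ ≤ Real.exp (t₀ * (1 / 2 - θ)) * Real.exp (θ * t₀) := by gcongr
        _ = Real.exp (t₀ / 2) := by rw [← Real.exp_add]; ring_nf
    have h4 : Real.exp (t₀ / 2) ≤ Real.exp ((t₀ + 1) / 2) := Real.exp_le_exp.2 (by linarith)
    linarith
  have hDM' : D₀ / M ≤ 1 := by rwa [div_le_one hMpos]
  set δ : ℝ := Real.sqrt (D₀ / M) with hδ
  have hδpos : 0 < δ := Real.sqrt_pos.2 (div_pos hD₀pos hMpos)
  have hδ1 : δ ≤ 1 := by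
    rw [hδ, ← Real.sqrt_one]
    exact Real.sqrt_le_sqrt hDM'
  have hδsq : δ ^ 2 = D₀ / M := Real.sq_sqrt (div_pos hD₀pos hMpos).le
  -- the gap at any `a ≤ t₀` with `a + 2 ≥ t₀ + 1` is at most `δ`
  have hgap : ∀ a : ℝ, a ≤ t₀ → t₀ + 1 ≤ a + 2 →
      Real.sqrt (K * Real.exp (θ * a) / (Real.exp ((a + 2) / 2) + 1)) ≤ δ := by
    intro a ha1 ha2
    rw [hδ]
    apply Real.sqrt_le_sqrt
    have hθa : θ * a ≤ θ * t₀ := mul_le_mul_of_nonneg_left ha1 hθ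
    have hnum : K * Real.exp (θ * a) ≤ D₀ :=
      mul_le_mul_of_nonneg_left (Real.exp_le_exp.2 hθa) hK.le
    have hden : M ≤ Real.exp ((a + 2) / 2) + 1 := by
      have := Real.exp_le_exp.2 (show (t₀ + 1) / 2 ≤ (a + 2) / 2 by linarith)
      linarith
    have hpos : 0 < Real.exp ((a + 2) / 2) + 1 := by positivity
    calc K * Real.exp (θ * a) / (Real.exp ((a + 2) / 2) + 1)
        ≤ D₀ / (Real.exp ((a + 2) / 2) + 1) := by gcongr
      _ ≤ D₀ / M := div_le_div_of_nonneg_left hD₀pos.le hMpos hden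
  obtain ⟨p, hp⟩ := zetaScrew_le_taylor h2
  rcases le_or_gt p 0 with hp0 | hp0
  · -- go right: a node in `[t₀, t₀ + g(t₀)]`
    obtain ⟨x, hxN, hx1, hx2⟩ := hT₀ t₀ (by linarith)
    have hg := hgap t₀ le_rfl (by linarith)
    have hxδ : x - t₀ ≤ δ := by linarith
    have hxw : x ∈ Icc (t₀ - 1) (t₀ + 1) := ⟨by linarith, by linarith⟩
    have hT := hp x hxw
    have hsq : (x - t₀) ^ 2 ≤ δ ^ 2 := pow_le_pow_left₀ (by linarith) hxδ 2
    have hquad : M / 2 * (x - t₀) ^ 2 ≤ D₀ / 2 := by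
      calc M / 2 * (x - t₀) ^ 2 ≤ M / 2 * δ ^ 2 := by gcongr
        _ = D₀ / 2 := by rw [hδsq]; field_simp
    have hlin : p * (x - t₀) ≤ 0 := mul_nonpos_of_nonpos_of_nonneg hp0 (by linarith)
    -- node depth at `x ≤ t₀ + 1`: `K e^{θx} ≤ e^{1/2} D₀ < 2 D₀`
    have hθx : θ * x ≤ θ * t₀ + 1 / 2 := by
      have := mul_le_mul_of_nonneg_left (show x ≤ t₀ + 1 by linarith) hθ
      nlinarith
    have hex : Real.exp (θ * x) ≤ Real.exp (1 / 2) * Real.exp (θ * t₀) := by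
      rw [← Real.exp_add]
      exact Real.exp_le_exp.2 (by linarith)
    have hKx : K * Real.exp (θ * x) ≤ 2 * D₀ := by
      calc K * Real.exp (θ * x) ≤ K * (Real.exp (1 / 2) * Real.exp (θ * t₀)) := by gcongr
        _ = Real.exp (1 / 2) * D₀ := by rw [hD₀]; ring
        _ ≤ 2 * D₀ := by gcongr; exact exp_half_lt_two.le
    have hnode := hΨN x hxN
    linarith
  · -- go left: a node in `[t₀ - δ, t₀]`
    obtain ⟨x, hxN, hx1, hx2⟩ := hT₀ (t₀ - δ) (by linarith)
    have hg := hgap (t₀ - δ) (by linarith) (by linarith)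
    have hxle : x ≤ t₀ := by linarith
    have hxw : x ∈ Icc (t₀ - 1) (t₀ + 1) := ⟨by linarith, by linarith⟩
    have hT := hp x hxw
    have hsq : (x - t₀) ^ 2 ≤ δ ^ 2 := by
      rw [← neg_sq, neg_sub]
      exact pow_le_pow_left₀ (by linarith) (by linarith) 2
    have hquad : M / 2 * (x - t₀) ^ 2 ≤ D₀ / 2 := by
      calc M / 2 * (x - t₀) ^ 2 ≤ M / 2 * δ ^ 2 := by gcongr
        _ = D₀ / 2 := by rw [hδsq]; field_simp
    have hlin : p * (x - t₀) ≤ 0 := mul_nonpos_of_nonneg_of_nonpos hp0.le (by linarith)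
    -- node depth at `x ≤ t₀`: `K e^{θx} ≤ D₀`
    have hKx : K * Real.exp (θ * x) ≤ D₀ := by
      rw [hD₀]
      exact mul_le_mul_of_nonneg_left (Real.exp_le_exp.2 (mul_le_mul_of_nonneg_left hxle hθ)) hK.le
    have hnode := hΨN x hxN
    linarith

/-- **Graded global slack.**  Under the hypotheses of `gradedTailFloor`, `Ψ(t) ≥ -(4K e^{θt} + K')`
for all `t ≥ 0`, for some constant `K' ≥ 0` (tail floor beyond `T₁`, continuity of `Ψ` on the
compact `[0, T₁]`). -/
theorem gradedGlobalSlack {θ K : ℝ} (hθ : 0 ≤ θ) (hθ' : θ < 1 / 2) (hK : 0 < K) {N : Set ℝ}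
    (hN : ∃ T₀ : ℝ, ∀ a : ℝ, T₀ ≤ a → ∃ x ∈ N, a ≤ x ∧
      x ≤ a + Real.sqrt (K * Real.exp (θ * a) / (Real.exp ((a + 2) / 2) + 1)))
    (hΨN : ∀ x ∈ N, -(K * Real.exp (θ * x)) ≤ zetaScrew x) :
    ∃ K' : ℝ, 0 ≤ K' ∧ ∀ t : ℝ, 0 ≤ t → -(4 * K * Real.exp (θ * t) + K') ≤ zetaScrew t := by
  obtain ⟨T₁, hT₁⟩ := gradedTailFloor hθ hθ' hK hN hΨN
  obtain ⟨m, hm⟩ := (isCompact_Icc (a := (0 : ℝ)) (b := T₁)).bddBelow_image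
    continuous_zetaScrew.continuousOn
  refine ⟨max 0 (-m), le_max_left _ _, fun t ht => ?_⟩
  have hexp : 0 ≤ 4 * K * Real.exp (θ * t) := by positivity
  rcases le_or_gt t T₁ with h | h
  · have : m ≤ zetaScrew t := hm ⟨t, ⟨ht, h⟩, rfl⟩
    have := le_max_right 0 (-m)
    linarith
  · have := hT₁ t h.le
    have := le_max_left 0 (-m)
    linarith

/-- **The graded sparse-node screw door (RH-free detection theorem).**  For every depth exponent
`θ ≥ 0` and `K > 0`: if the node set `N ⊆ ℝ` meets every interval
`[a, a + √(K e^{θa}/(e^{(a+2)/2}+1))]` for all large `a` (`x`-gap `≍ x^{3/4+θ/2}` in `x = e^a`) and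
`Ψ(x) ≥ -K e^{θx}` for every node `x ∈ N`, then `ζ` has no zero with `1/2 + θ < Re s < 1`
(`QuasiRiemannHypothesis (1/2 + θ)`).  Proof: `gradedGlobalSlack` makes `D = 4K e^{θt} + K'` a slack
with `Ψ ≥ -D` on `[0,∞)`; `D` has Laplace class `β` for every `β > θ`, so the slack-function Landau
theorem `ZetaScrewLandau.quasiRiemannHypothesis_of_zetaScrew_ge_neg_slack` gives `QuasiRH(1/2 + β)`
for every `β > θ`; a zero with `Re s > 1/2 + θ` is caught by `β = (θ + Re s - 1/2)/2`.  (For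
`θ ≥ 1/2` the conclusion is vacuous.)  At `θ = 0` this is the landed door `sparseNodeDoor`
(stmt-22169).  RH is not proved by this; nothing here bears on the truth of RH. -/
theorem gradedSparseDoor {θ K : ℝ} (hθ : 0 ≤ θ) (hK : 0 < K) {N : Set ℝ}
    (hN : ∃ T₀ : ℝ, ∀ a : ℝ, T₀ ≤ a → ∃ x ∈ N, a ≤ x ∧
      x ≤ a + Real.sqrt (K * Real.exp (θ * a) / (Real.exp ((a + 2) / 2) + 1)))
    (hΨN : ∀ x ∈ N, -(K * Real.exp (θ * x)) ≤ zetaScrew x) :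
    QuasiRiemannHypothesis (1 / 2 + θ) := by
  intro s hs h₁ h₂
  rcases le_or_gt (1 / 2 : ℝ) θ with hθ' | hθ'
  · linarith
  obtain ⟨K', hK'0, hK'⟩ := gradedGlobalSlack hθ hθ' hK hN hΨN
  -- a Laplace class `β` strictly between `θ` and `Re s - 1/2`
  set β : ℝ := (θ + (s.re - 1 / 2)) / 2 with hβ
  have hθβ : θ < β := by rw [hβ]; linarith
  have hβs : 1 / 2 + β < s.re := by rw [hβ]; linarith
  have hβ0 : 0 ≤ β := by linarith
  have hDm : Measurable (fun t : ℝ => 4 * K * Real.exp (θ * t) + K') :=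
    ((continuous_const.mul (Real.continuous_exp.comp (continuous_const.mul continuous_id))).add
      continuous_const).measurable
  have hDint : IntegrableOn
      (fun t : ℝ => (4 * K * Real.exp (θ * t) + K') * Real.exp (-β * t)) (Ioi 0) := by
    have i1 : IntegrableOn (fun t : ℝ => 4 * K * Real.exp ((θ - β) * t)) (Ioi 0) :=
      (integrableOn_exp_mul_Ioi (by linarith) 0).const_mul (4 * K)
    have i2 : IntegrableOn (fun t : ℝ => K' * Real.exp (-β * t)) (Ioi 0) :=
      (integrableOn_exp_mul_Ioi (by linarith) 0).const_mul K'
    refine (i1.add i2).congr_fun (fun t _ => ?_) measurableSet_Ioi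
    simp only [Pi.add_apply]
    rw [show (θ - β) * t = θ * t + -β * t by ring, Real.exp_add]
    ring
  exact ZetaScrewLandau.quasiRiemannHypothesis_of_zetaScrew_ge_neg_slack hDm hβ0 hDint hK' s hs
    hβs h₂

/-- **`θ = 0`: the graded door contains the landed door.**  With constant depth `K` and gap
`√(K/(e^{(a+2)/2}+1))` (the hypotheses of `ScrewQuarticNodes.SparseNodeDoor`, stmt-22169),
`gradedSparseDoor` gives `QuasiRH(1/2)`, i.e. RH (`quasiRiemannHypothesis_one_half_iff_holds`). -/
theorem rh_of_gradedSparseDoor_zero {K : ℝ} (hK : 0 < K) {N : Set ℝ}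
    (hN : ∃ T₀ : ℝ, ∀ a : ℝ, T₀ ≤ a →
      ∃ x ∈ N, a ≤ x ∧ x ≤ a + Real.sqrt (K / (Real.exp ((a + 2) / 2) + 1)))
    (hΨN : ∀ x ∈ N, -K ≤ zetaScrew x) : _root_.RiemannHypothesis := by
  have hN' : ∃ T₀ : ℝ, ∀ a : ℝ, T₀ ≤ a → ∃ x ∈ N, a ≤ x ∧
      x ≤ a + Real.sqrt (K * Real.exp (0 * a) / (Real.exp ((a + 2) / 2) + 1)) := by
    simpa using hN
  have hΨN' : ∀ x ∈ N, -(K * Real.exp (0 * x)) ≤ zetaScrew x := by simpa using hΨN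
  have h := gradedSparseDoor le_rfl hK hN' hΨN'
  rw [add_zero] at h
  exact quasiRiemannHypothesis_one_half_iff_holds.1 h

end Summit.RiemannHypothesis.RiemannHypothesis.Theorems.ScrewQuarticNodesGradedDoor

end
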